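import Mathlib
import Literature.NumberTheory.LFunctions.Zhang2022.Section17Eq179ChiEdgesE
import Literature.NumberTheory.LFunctions.Zhang2022.Section17U021ChiR2
import Literature.NumberTheory.LFunctions.Zhang2022.Section17U021ChiDecomposition
import HarnessLib

/-!
# Zhang (2022) §17.u021 (χ-reading), the `m₂ ≥ 2` remainder `R₁` IN THE RELATIVE BUDGET: the consumer
# edge `R₁ = o(𝔞+1) → Lemma 15.1 (χ,E) → u024-χ (rel., E) → (17.9)ᴿ at the parameter`, kernel-checked

Topic `Literature/NumberTheory/LFunctions/Zhang2022` (Landau–Siegel audit tree; verdict-neutral).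
Y. Zhang, *Discrete mean estimates and the Landau–Siegel zero*, arXiv:2211.02515v1 (2022)
[Zhang2022LandauSiegel] — **an unrefereed manuscript under adjudication; nothing here asserts or denies
its Theorems 1–2, and no claim about Landau–Siegel zeros is made.** Lane ZHANG-L, WP16, leaf h17_9
(`Typed.Section17.Eq17_9RelE e1ppD c′`); sub-leaf `R₁` of the χ-node `Typed.Section17.Step17_u021Chi`
(§17 p. 98, tex L4825: "On the right side above, we can drop the terms with `m₂ > 1` or `(m₁,𝔮) > 1` with
an acceptable error" — no bound in print).

STATE OF THE CHAIN (tree): `Σ_n ((bχ)∗ν₁*)(n)ϱ*(n)/n = MAIN + R₂ + R₁` exactly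
(`Typed.Section17.tsum_conv_varrho17_chi_decomposition`); `R₂ = o(1)` is a theorem
(`Phi3Eval.step17_u021Chi_R2_holds`); the typed node `Step17_u021Chi c′` is the ABSOLUTE statement
`R₁ + R₂ = o(1)` (`step17_u021Chi_of_remainders`), consumed by the E-chain
`Phi3Eval.step17_u024ChiRelE_of → step17_u026RelE_of → eq17_9RelE_of_u026RelE` whose own currency is the
RELATIVE budget `ε(𝔞+1)` of record (D-G-L4fam-1; `Step17_u024ChiRelE`, `Step17_u026RelE`, `Eq17_9RelE`).

WHY THIS FILE (owner's first deliverable for the sub-leaf `R₁`, zl-lead R₁ PAIRING 2026-08-27T01:33Z;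
zl-libA-typer's MEMO-u021chi-R1.md §5: absolute divisor majorants miss `R₁ = o(1)` by a power `𝓛^{≈4}`,
which is the size of the outer count `Σ_{l<D⁴}ν(l)(τ₂∗·)(l)/l ≍ 𝔞`): the remainder `R₁` need only be
shown NEGLIGIBLE IN THE CHAIN'S OWN CURRENCY, `‖R₁‖ ≤ ε(𝔞+1)`, not absolutely. This file proves that the
relative estimate suffices, with no other change to the chain:

* `norm_main_sub_frakeE_mul_le` — the `𝔢₁`-substitution step isolated (u023-χ at the parameter and
  printed rate, `Phi3Eval.step17_u023ChiRE_of_lemma151ChiRE`, + the summed error at rate `α₁`,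
  `Phi3Eval.step17_hE_alpha1_holds`): under (A), `‖MAIN − 𝔢₁[e1pp]·W‖ ≤ ε` eventually, where
  `W = Σ_{l<D⁴}(ν(l)/l)Σ_{l=l₁l₂}χ(l₁)τ₂(l₁)ν₁*(l₂)` (zl-w16-p3's bookkeeping of `step17_u024Chi_of`,
  re-run without the u021 input);
* **`step17_u024ChiRelE_of_R1Rel`** — `(R₁ = o(𝔞+1)) → Lemma151ChiRE e1pp c′ → Step17_u024ChiRelE e1pp c′`
  (typed E-node BY NAME): decomposition + `R₂ = o(1)` + the bullet above + `‖R₁‖ ≤ ε(𝔞+1)`;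
* **`eq17_9RelE_of_R1Rel`** — the LEAF at the parameter from `Eq17_7 c′`, `Eq17_8Chi c′`, `R₁ = o(𝔞+1)`
  and `Lemma151ChiRE e1pp c′` (`step17_u026RelE_of`, `step17_u025E_holds`, `eq17_9RelE_of_u026RelE`);
  at `e1pp := e1ppD` the conclusion is the skeleton binder `h17_9` BY NAME;
* `R1Rel_of_R1` — the absolute remainder estimate (hypothesis `hR₁` of `step17_u021Chi_of_remainders`)
  implies the relative one, so nothing proved for the absolute node is lost.

The hypothesis `R₁ = o(𝔞+1)` is SPELLED INLINE (the `m₂ ≥ 2` sum of `tsum_conv_varrho17_chi_decomposition`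
verbatim, bound `ε * (frakA χ + 1)`); no new definition, no new named fact. WHAT THIS IS NOT: a proof of
`R₁ = o(𝔞+1)` (the sub-leaf itself), of (17.8)-χ, (17.7) or Lemma 15.1; any claim about Theorems 1–2.

## References

* Y. Zhang, arXiv:2211.02515v1 (2022), §17 p. 98 (u021–u026, tex L4821–L4845), (17.9); §15
  Lemma 15.1 p. 86. [cite: Zhang2022LandauSiegel, §17 u021 p.98]
-/

noncomputable section

open Complex Real Finset
open Literature.NumberTheory.LFunctions.Zhang2022.Skeleton
open Literature.NumberTheory.LFunctions.Zhang2022.Typed.Section17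

namespace Literature.NumberTheory.LFunctions.Zhang2022.Phi3Eval

/-! ## §1. The `𝔢₁`-substitution on the kept sum, isolated -/

/-- **`‖MAIN − 𝔢₁[e1pp]·W‖ ≤ ε` eventually, under (A)** — where `MAIN` is the kept sum of
`Step17_u021Chi` (`m₂ = 1`, `(m₁,𝔮) = 1`) and `W = Σ_{l<D⁴}(ν(l)/l)Σ_{l=l₁l₂}χ(l₁)τ₂(l₁)ν₁*(l₂)`: pull
`ν₁*(l₂)` out, substitute u023-χ at the parameter (`step17_u023ChiRE_of_lemma151ChiRE`, from
`Lemma151ChiRE e1pp c′`) termwise, and sum the errors `C·α₁·τ₂(l₁)|ν₁*(l₂)|` with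
`step17_hE_alpha1_holds` (row G-d58-1). zl-w16-p3's bookkeeping (`step17_u024Chi_of`) with the u021 input
removed. [cite: Zhang2022LandauSiegel, §17 u023–u024 p.98] -/
theorem norm_main_sub_frakeE_mul_le (e1pp : ℕ → ℂ) (c' : ℝ) (h151 : Lemma151ChiRE e1pp c') :
    ∀ ε : ℝ, 0 < ε → ForAllLarge fun D _ χ => AssumptionA D χ →
      ‖(∑ l ∈ Finset.Ico 1 (D ^ 4), nu χ l / (l : ℂ) *
          ∑ q ∈ l.divisorsAntidiagonal, ∑' m₁ : ℕ,
            if Nat.Coprime m₁ (frakq D) then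
              bcoef D (q.1 * m₁) * χ ((q.1 * m₁ : ℕ) : ZMod D) * nuOneStar c' χ q.2 *
                kappa2bar c' D m₁ / (m₁ : ℂ)
            else 0) -
        frakeE e1pp 1 * ∑ l ∈ Finset.Ico 1 (D ^ 4), nu χ l / (l : ℂ) *
          ∑ q ∈ l.divisorsAntidiagonal,
            χ (q.1 : ZMod D) * (q.1.divisors.card : ℂ) * nuOneStar c' χ q.2‖ ≤ ε := by
  intro ε hε
  obtain ⟨C, hC⟩ := step17_u023ChiRE_of_lemma151ChiRE e1pp c' h151
  have hδ : 0 < ε / (|C| + 1) := by positivity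
  obtain ⟨D₀, h⟩ := hC.and (step17_hE_alpha1_holds c' _ hδ)
  refine ⟨D₀, fun D _ χ hD hq hp hA => ?_⟩
  obtain ⟨e23, eE⟩ := h D χ hD hq hp
  replace e23 := e23 hA
  replace eE := eE hA
  -- names
  set inner : ℕ → ℂ := fun l₁ => ∑' m₁ : ℕ,
    if Nat.Coprime m₁ (frakq D) then
      bcoef D (l₁ * m₁) * χ ((l₁ * m₁ : ℕ) : ZMod D) * kappa2bar c' D m₁ / (m₁ : ℂ) else 0
    with hinner
  set U : ℂ := ∑ l ∈ Finset.Ico 1 (D ^ 4), nu χ l / (l : ℂ) *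
    ∑ q ∈ l.divisorsAntidiagonal, ∑' m₁ : ℕ,
      if Nat.Coprime m₁ (frakq D) then
        bcoef D (q.1 * m₁) * χ ((q.1 * m₁ : ℕ) : ZMod D) * nuOneStar c' χ q.2 *
          kappa2bar c' D m₁ / (m₁ : ℂ) else 0 with hU
  set W : ℂ := ∑ l ∈ Finset.Ico 1 (D ^ 4), nu χ l / (l : ℂ) *
    ∑ q ∈ l.divisorsAntidiagonal, χ (q.1 : ZMod D) * (q.1.divisors.card : ℂ) * nuOneStar c' χ q.2
    with hW
  set E : ℝ := ∑ l ∈ Finset.Ico 1 (D ^ 4), ‖nu χ l‖ / l *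
    ∑ q ∈ l.divisorsAntidiagonal, (q.1.divisors.card : ℝ) * ‖nuOneStar c' χ q.2‖ with hEdef
  -- pull `ν₁*(l₂)` out of the inner series
  have hpull : ∀ l₁ l₂ : ℕ, (∑' m₁ : ℕ, if Nat.Coprime m₁ (frakq D) then
      bcoef D (l₁ * m₁) * χ ((l₁ * m₁ : ℕ) : ZMod D) * nuOneStar c' χ l₂ * kappa2bar c' D m₁ / (m₁ : ℂ)
      else 0) = nuOneStar c' χ l₂ * inner l₁ := by
    intro l₁ l₂
    rw [hinner]
    simp only
    rw [← tsum_mul_left]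
    refine tsum_congr fun m₁ => ?_
    split_ifs
    · ring
    · simp
  have hU' : U = ∑ l ∈ Finset.Ico 1 (D ^ 4), nu χ l / (l : ℂ) *
      ∑ q ∈ l.divisorsAntidiagonal, nuOneStar c' χ q.2 * inner q.1 := by
    rw [hU]
    refine Finset.sum_congr rfl fun l _ => ?_
    congr 1
    exact Finset.sum_congr rfl fun q _ => hpull q.1 q.2
  -- the termwise substitution of u023-χ
  have hdiff : U - frakeE e1pp 1 * W = ∑ l ∈ Finset.Ico 1 (D ^ 4), nu χ l / (l : ℂ) *
      ∑ q ∈ l.divisorsAntidiagonal, nuOneStar c' χ q.2 *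
        (inner q.1 - frakeE e1pp 1 * χ (q.1 : ZMod D) * (q.1.divisors.card : ℂ)) := by
    rw [hU', hW, Finset.mul_sum, ← Finset.sum_sub_distrib]
    refine Finset.sum_congr rfl fun l _ => ?_
    rw [← mul_assoc, mul_comm (frakeE e1pp 1) (nu χ l / (l : ℂ)), mul_assoc, ← mul_sub, Finset.mul_sum,
      ← Finset.sum_sub_distrib]
    congr 1
    refine Finset.sum_congr rfl fun q _ => ?_
    ring
  have hbound : ‖U - frakeE e1pp 1 * W‖ ≤ C * alpha1 D * E := by
    rw [hdiff]
    refine (norm_sum_le _ _).trans ?_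
    rw [hEdef, Finset.mul_sum]
    refine Finset.sum_le_sum fun l hl => ?_
    rw [norm_mul, norm_div, Complex.norm_natCast]
    have hl0 : (0 : ℝ) ≤ ‖nu χ l‖ / (l : ℝ) := by positivity
    rw [mul_comm (C * alpha1 D), mul_assoc]
    refine mul_le_mul_of_nonneg_left ?_ hl0
    refine (norm_sum_le _ _).trans ?_
    rw [Finset.sum_mul]
    refine Finset.sum_le_sum fun q hq => ?_
    have hl' := Finset.mem_Ico.1 hl
    have hq' := Nat.mem_divisorsAntidiagonal.1 hq
    have hq1dvd : q.1 ∣ l := ⟨q.2, hq'.1.symm⟩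
    have hq1pos : 0 < q.1 := Nat.pos_of_ne_zero fun h0 => hq'.2 (by rw [← hq'.1, h0, zero_mul])
    have hq1 : 1 ≤ q.1 := hq1pos
    have hq4 : q.1 < D ^ 4 := lt_of_le_of_lt (Nat.le_of_dvd (by omega) hq1dvd) hl'.2
    rw [norm_mul]
    have h23q := e23 q.1 hq1 hq4
    calc ‖nuOneStar c' χ q.2‖ * ‖inner q.1 - frakeE e1pp 1 * χ (q.1 : ZMod D) * (q.1.divisors.card : ℂ)‖
        ≤ ‖nuOneStar c' χ q.2‖ * (C * alpha1 D * q.1.divisors.card) :=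
          mul_le_mul_of_nonneg_left h23q (norm_nonneg _)
      _ = (q.1.divisors.card : ℝ) * ‖nuOneStar c' χ q.2‖ * (C * alpha1 D) := by ring
  -- sizes
  have hℓ : 0 ≤ ell D := Real.log_natCast_nonneg D
  have hα : 0 ≤ alpha D := by
    rw [alpha, bigP, Real.log_exp]; exact div_nonneg Real.pi_pos.le (pow_nonneg hℓ 9)
  have hα1 : 0 ≤ alpha1 D := by
    rw [alpha1, log_bigT]; exact mul_nonneg hα (Real.rpow_nonneg hℓ _)
  have hE0 : 0 ≤ E := Finset.sum_nonneg fun l _ => mul_nonneg (by positivity)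
    (Finset.sum_nonneg fun q _ => by positivity)
  have hαℓE : 0 ≤ alpha1 D * E := mul_nonneg hα1 hE0
  show ‖U - frakeE e1pp 1 * W‖ ≤ ε
  calc ‖U - frakeE e1pp 1 * W‖ ≤ C * alpha1 D * E := hbound
    _ = C * (alpha1 D * E) := by ring
    _ ≤ |C| * (alpha1 D * E) := mul_le_mul_of_nonneg_right (le_abs_self C) hαℓE
    _ ≤ |C| * (ε / (|C| + 1)) := mul_le_mul_of_nonneg_left eE (abs_nonneg C)
    _ ≤ ε := by
        rw [mul_div_assoc', div_le_iff₀ (by positivity)]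
        nlinarith [abs_nonneg C]

/-! ## §2. The relative remainder estimate suffices for u024-χ (rel., E) and for the leaf -/

/-- **The absolute remainder estimate implies the relative one** (`𝔞 ≥ 0`): the hypothesis `hR₁` of
`Typed.Section17.step17_u021Chi_of_remainders` implies the hypothesis of `step17_u024ChiRelE_of_R1Rel`.
[cite: Zhang2022LandauSiegel, §17 u021 p.98] -/
theorem R1Rel_of_R1 {c' : ℝ}
    (hR₁ : ∀ ε : ℝ, 0 < ε → ForAllLarge fun D _ χ => AssumptionA D χ →
      ‖∑ l ∈ Finset.Ico 1 (D ^ 4), nu χ l / (l : ℂ) *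
          ∑ q ∈ l.divisorsAntidiagonal, ∑' m₁ : ℕ, ∑' m₂ : ℕ,
            if 2 ≤ m₂ ∧ Nat.Coprime m₂ q.1 then
              bcoef D (q.1 * m₁) * χ ((q.1 * m₁ : ℕ) : ZMod D) * nuOneStar c' χ (q.2 * m₂) *
                kappa2bar c' D (m₁ * m₂) / ((m₁ : ℂ) * m₂)
            else 0‖ ≤ ε) :
    ∀ ε : ℝ, 0 < ε → ForAllLarge fun D _ χ => AssumptionA D χ →
      ‖∑ l ∈ Finset.Ico 1 (D ^ 4), nu χ l / (l : ℂ) *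
          ∑ q ∈ l.divisorsAntidiagonal, ∑' m₁ : ℕ, ∑' m₂ : ℕ,
            if 2 ≤ m₂ ∧ Nat.Coprime m₂ q.1 then
              bcoef D (q.1 * m₁) * χ ((q.1 * m₁ : ℕ) : ZMod D) * nuOneStar c' χ (q.2 * m₂) *
                kappa2bar c' D (m₁ * m₂) / ((m₁ : ℂ) * m₂)
            else 0‖ ≤ ε * (frakA χ + 1) := fun ε hε =>
  (hR₁ ε hε).mono fun D _ χ _ _ h hA => by
    have e := h hA
    have hA0 : 0 ≤ frakA χ := frakA_nonneg χ
    nlinarith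

/-- **u024-χ in the relative budget at the parameter — `Typed.Section17.Step17_u024ChiRelE e1pp c′` BY
NAME — from the RELATIVE remainder estimate `R₁ = o(𝔞+1)`** (the `m₂ ≥ 2` sum of
`tsum_conv_varrho17_chi_decomposition`, spelled inline with the bound `ε·(frakA χ + 1)`) and
`Lemma151ChiRE e1pp c′`: `V = MAIN + R₂ + R₁` (exact), `‖MAIN − 𝔢₁W‖ ≤ ε/3`
(`norm_main_sub_frakeE_mul_le`), `‖R₂‖ ≤ ε/3` (`step17_u021Chi_R2_holds`), `‖R₁‖ ≤ (ε/3)(𝔞+1)`.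
[cite: Zhang2022LandauSiegel, §17 u021–u024 p.98] -/
theorem step17_u024ChiRelE_of_R1Rel (e1pp : ℕ → ℂ) (c' : ℝ)
    (hR₁ : ∀ ε : ℝ, 0 < ε → ForAllLarge fun D _ χ => AssumptionA D χ →
      ‖∑ l ∈ Finset.Ico 1 (D ^ 4), nu χ l / (l : ℂ) *
          ∑ q ∈ l.divisorsAntidiagonal, ∑' m₁ : ℕ, ∑' m₂ : ℕ,
            if 2 ≤ m₂ ∧ Nat.Coprime m₂ q.1 then
              bcoef D (q.1 * m₁) * χ ((q.1 * m₁ : ℕ) : ZMod D) * nuOneStar c' χ (q.2 * m₂) *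
                kappa2bar c' D (m₁ * m₂) / ((m₁ : ℂ) * m₂)
            else 0‖ ≤ ε * (frakA χ + 1))
    (h151 : Lemma151ChiRE e1pp c') : Step17_u024ChiRelE e1pp c' := by
  intro ε hε
  have hε3 : 0 < ε / 3 := by positivity
  obtain ⟨D₀, h⟩ := ((norm_main_sub_frakeE_mul_le e1pp c' h151 _ hε3).and
    (step17_u021Chi_R2_holds c' _ hε3)).and (hR₁ _ hε3)
  refine ⟨D₀, fun D _ χ hD hq hp hA => ?_⟩
  obtain ⟨⟨eM, e₂⟩, e₁⟩ := h D χ hD hq hp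
  replace eM := eM hA
  replace e₂ := e₂ hA
  replace e₁ := e₁ hA
  -- names
  set V : ℂ := ∑' n : ℕ, LSeries.convolution (fun n => bcoef D n * χ (n : ZMod D)) (nuOneStar c' χ) n *
    varrho17 c' χ n / (n : ℂ) with hV
  set U : ℂ := ∑ l ∈ Finset.Ico 1 (D ^ 4), nu χ l / (l : ℂ) *
    ∑ q ∈ l.divisorsAntidiagonal, ∑' m₁ : ℕ,
      if Nat.Coprime m₁ (frakq D) then
        bcoef D (q.1 * m₁) * χ ((q.1 * m₁ : ℕ) : ZMod D) * nuOneStar c' χ q.2 *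
          kappa2bar c' D m₁ / (m₁ : ℂ) else 0 with hU
  set R₂ : ℂ := ∑ l ∈ Finset.Ico 1 (D ^ 4), nu χ l / (l : ℂ) *
    ∑ q ∈ l.divisorsAntidiagonal, ∑' m₁ : ℕ,
      if ¬ Nat.Coprime m₁ (frakq D) then
        bcoef D (q.1 * m₁) * χ ((q.1 * m₁ : ℕ) : ZMod D) * nuOneStar c' χ q.2 *
          kappa2bar c' D m₁ / (m₁ : ℂ) else 0 with hR₂
  set R₁ : ℂ := ∑ l ∈ Finset.Ico 1 (D ^ 4), nu χ l / (l : ℂ) *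
    ∑ q ∈ l.divisorsAntidiagonal, ∑' m₁ : ℕ, ∑' m₂ : ℕ,
      if 2 ≤ m₂ ∧ Nat.Coprime m₂ q.1 then
        bcoef D (q.1 * m₁) * χ ((q.1 * m₁ : ℕ) : ZMod D) * nuOneStar c' χ (q.2 * m₂) *
          kappa2bar c' D (m₁ * m₂) / ((m₁ : ℂ) * m₂)
      else 0 with hR₁
  set W : ℂ := ∑ l ∈ Finset.Ico 1 (D ^ 4), nu χ l / (l : ℂ) *
    ∑ q ∈ l.divisorsAntidiagonal, χ (q.1 : ZMod D) * (q.1.divisors.card : ℂ) * nuOneStar c' χ q.2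
    with hW
  have hdec : V = U + R₂ + R₁ := tsum_conv_varrho17_chi_decomposition c' χ
  have hA0 : 0 ≤ frakA χ := frakA_nonneg χ
  have hsplit : V - frakeE e1pp 1 * W = (U - frakeE e1pp 1 * W) + R₂ + R₁ := by rw [hdec]; ring
  show ‖V - frakeE e1pp 1 * W‖ ≤ ε * (frakA χ + 1)
  rw [hsplit]
  calc ‖(U - frakeE e1pp 1 * W) + R₂ + R₁‖ ≤ ‖(U - frakeE e1pp 1 * W) + R₂‖ + ‖R₁‖ := norm_add_le _ _
    _ ≤ ‖U - frakeE e1pp 1 * W‖ + ‖R₂‖ + ‖R₁‖ := by gcongr; exact norm_add_le _ _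
    _ ≤ ε / 3 + ε / 3 + ε / 3 * (frakA χ + 1) := add_le_add (add_le_add eM e₂) e₁
    _ ≤ ε * (frakA χ + 1) := by nlinarith

/-- **u026 at the parameter, relative budget, from the RELATIVE `R₁`**: `Eq17_8Chi c′ → (R₁ = o(𝔞+1)) →
Lemma151ChiRE e1pp c′ → Step17_u026RelE e1pp c′` (`step17_u026RelE_of` with u025 at the parameter the
theorem `step17_u025E_holds`). [cite: Zhang2022LandauSiegel, §17 u026 p.98] -/
theorem step17_u026RelE_of_R1Rel (e1pp : ℕ → ℂ) (c' : ℝ) (h8 : Eq17_8Chi c')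
    (hR₁ : ∀ ε : ℝ, 0 < ε → ForAllLarge fun D _ χ => AssumptionA D χ →
      ‖∑ l ∈ Finset.Ico 1 (D ^ 4), nu χ l / (l : ℂ) *
          ∑ q ∈ l.divisorsAntidiagonal, ∑' m₁ : ℕ, ∑' m₂ : ℕ,
            if 2 ≤ m₂ ∧ Nat.Coprime m₂ q.1 then
              bcoef D (q.1 * m₁) * χ ((q.1 * m₁ : ℕ) : ZMod D) * nuOneStar c' χ (q.2 * m₂) *
                kappa2bar c' D (m₁ * m₂) / ((m₁ : ℂ) * m₂)
            else 0‖ ≤ ε * (frakA χ + 1))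
    (h151 : Lemma151ChiRE e1pp c') : Step17_u026RelE e1pp c' :=
  step17_u026RelE_of e1pp h8 (step17_u024ChiRelE_of_R1Rel e1pp c' hR₁ h151) (step17_u025E_holds e1pp c')

/-- **The leaf (17.9)ᴿ at the parameter from the RELATIVE `R₁`**: `Eq17_7 c′ → Eq17_8Chi c′ →
(R₁ = o(𝔞+1)) → Skeleton.Lemma151ChiRE e1pp c′ → Typed.Section17.Eq17_9RelE e1pp c′`. At `e1pp := e1ppD`
the conclusion is the skeleton binder `h17_9` BY NAME (`SkeletonWholeDAGv27` and later).
[cite: Zhang2022LandauSiegel, §17 (17.9) p.98] -/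
theorem eq17_9RelE_of_R1Rel (e1pp : ℕ → ℂ) (c' : ℝ) (h7 : Eq17_7 c') (h8 : Eq17_8Chi c')
    (hR₁ : ∀ ε : ℝ, 0 < ε → ForAllLarge fun D _ χ => AssumptionA D χ →
      ‖∑ l ∈ Finset.Ico 1 (D ^ 4), nu χ l / (l : ℂ) *
          ∑ q ∈ l.divisorsAntidiagonal, ∑' m₁ : ℕ, ∑' m₂ : ℕ,
            if 2 ≤ m₂ ∧ Nat.Coprime m₂ q.1 then
              bcoef D (q.1 * m₁) * χ ((q.1 * m₁ : ℕ) : ZMod D) * nuOneStar c' χ (q.2 * m₂) *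
                kappa2bar c' D (m₁ * m₂) / ((m₁ : ℂ) * m₂)
            else 0‖ ≤ ε * (frakA χ + 1))
    (h151 : Lemma151ChiRE e1pp c') : Eq17_9RelE e1pp c' :=
  eq17_9RelE_of_u026RelE e1pp c' h7 (step17_u026RelE_of_R1Rel e1pp c' h8 hR₁ h151)

/-- Sanity: the ABSOLUTE remainder estimate (hypothesis `hR₁` of `step17_u021Chi_of_remainders`) feeds
the same leaf edge through `R1Rel_of_R1`. [cite: Zhang2022LandauSiegel, §17 (17.9) p.98] -/
example (e1pp : ℕ → ℂ) (c' : ℝ) (h7 : Eq17_7 c') (h8 : Eq17_8Chi c')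
    (hR₁ : ∀ ε : ℝ, 0 < ε → ForAllLarge fun D _ χ => AssumptionA D χ →
      ‖∑ l ∈ Finset.Ico 1 (D ^ 4), nu χ l / (l : ℂ) *
          ∑ q ∈ l.divisorsAntidiagonal, ∑' m₁ : ℕ, ∑' m₂ : ℕ,
            if 2 ≤ m₂ ∧ Nat.Coprime m₂ q.1 then
              bcoef D (q.1 * m₁) * χ ((q.1 * m₁ : ℕ) : ZMod D) * nuOneStar c' χ (q.2 * m₂) *
                kappa2bar c' D (m₁ * m₂) / ((m₁ : ℂ) * m₂)
            else 0‖ ≤ ε)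
    (h151 : Lemma151ChiRE e1pp c') : Eq17_9RelE e1pp c' :=
  eq17_9RelE_of_R1Rel e1pp c' h7 h8 (R1Rel_of_R1 hR₁) h151

end Literature.NumberTheory.LFunctions.Zhang2022.Phi3Eval
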